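/-
Copyright (c) 2026 the pub-hodgecm-mathlib formalisation cell (harness21).  Prover seat hodgecm-mathlib-LH4-p13 (g0): Track A «(D-RAM) FOUR-FRAME» squad of crux H413
(dealer LH4-plan (g10) WORD #29 «p13 → (e) `stub_U2H_typeTwoRow_wild`»; LH4-p06 (g0) ED. 4∕5 design (e₀); LH4-p05 (g0) CENSUS v2 (f) «type dichotomy»), 2026-09-03.
-/
import Literature.NumberTheory.Automorphic.SLTwoTreeUnramifiedEllipticFixedBall   -- ★ (A-p12 (g23)): transport `#Fix(hgh⁻¹) = #Fix(g)`, `Fix(c·g) = Fix(g)`; brings ★ p846991 the INERT vertex ball in `(u, v)`-tokens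
import Literature.NumberTheory.Automorphic.SLTwoTreeRamifiedEllipticFixedBall     -- ★ (A-p12 (g23)): `ncard_setOf_glVertexAct_torus_eq_self_of_eisenstein` (the EISENSTEIN edge ball in `(u, v)`-tokens); brings ★ (W′1) VI
import HarnessLib

/-!
# Fixed vertices of an ELLIPTIC element of `GL₂(F)` on the tree of `SL₂(F)` in TORUS-FORM tokens, ANY residue characteristic:
# `(q − 1)·#Fix(g) + 2 = (q + 1)·qⁿ` (INERT order `𝒪[τ]`, `τ² = uτ + v` anisotropic mod `𝔭`) ∕ `= 2·q^{n+1}` (EISENSTEIN order, `|u| < 1`, `|v| = |ϖ|`),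
# for `g` conjugate up to a scalar to a unit `a + bτ` with `|b| = |ϖ|ⁿ` (Labesse–Langlands 1979 §2 p. 8; Serre, *Trees* II.1.1; Kottwitz 1988 §2)

Topic `NumberTheory/Automorphic`; namespace `Literature.NumberTheory.Automorphic.HermitianLatticeTree` (ROAD W's, as ★ `SLTwoTreeUnramifiedEllipticFixedBall` ∕
★ `SLTwoTreeRamifiedEllipticFixedBall`).  KERNEL mathematics only: theorems, no definition, no named fact, no instance, no notation, no `sorry`; lane `--supports
stmt-HodgeConjecture-24833`.  Cell `pub/hodgecm-mathlib` (D-0151), crux H413; Track A «(D-RAM) FOUR-FRAME», unit U2H (ii-H), child (e) `stub_U2H_typeTwoRow_wild` (dealer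
LH4-plan (g10) WORD #29; LH4-p06 (g0) ED. 4∕5 (e₀)): the DYADIC-SAFE form of the two tame ball heads ★ `ncard_setOf_glVertexAct_eq_self_of_unramified_elliptic` (2u) and ★
`ncard_setOf_glVertexAct_eq_self_of_ramified_elliptic` (2r).  HONEST LABEL: HC_CM is proved only modulo the 7 printed citations (2 remaining named inputs: hLiu418 =
stmt-HodgeConjecture-24832, h413 = stmt-HodgeConjecture-24833) until rung 0 closes; nothing printed is asserted here — two short compositions of ★ theorems.

WHY.  The tame heads (2u)∕(2r) read the eigen-order of `g` off its DESCENT `t² − 4d = ε₀z²` (`ε₀` a unit of NON-SQUARE RESIDUE) resp. `= π₁z²`, via `g ~ (t∕2)(1 + eτ)` (★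
`exists_conj_eq_smul_regRepOne`, binder `2 ≠ 0`).  At a DYADIC `F` the first is VACUOUS (squaring is onto the residue field, so no unit has non-square residue and the binder
`hns : ∀ b ∈ 𝒪, |b² − ε₀| = 1` has no instance) and the second covers only the uniformiser square class, with the depth token `n` off by the `|2|`-correction of the
eigen-order conductor.  But the ENGINES underneath are residue-characteristic-free and already typed in torus-form tokens `(u, v)`: ★ p846991
`ncard_setOf_glVertexAct_torus_eq_self_of_inert` (INERT SHAPE `hanis`: the norm form `c² + ceu − e²v` is anisotropic modulo `𝔭` — at a dyadic `F` the unramified quadratic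
order is `𝒪[τ]`, `τ² = τ + ρ`, Artin–Schreier) and ★ `ncard_setOf_glVertexAct_torus_eq_self_of_eisenstein` (EISENSTEIN SHAPE `|u| < 1`, `|v| = |ϖ|` — every totally ramified
quadratic extension, wild included, is generated by a uniformiser root of an Eisenstein polynomial).  THIS FILE packages them for an arbitrary elliptic `g`: if `h g h⁻¹ = c·γ₁`
with `γ₁ = (a, bv; b, a + bu)` a UNIT of the order (`a b ∈ 𝒪`, `|det γ₁| = 1`) and `|b| = |ϖ|ⁿ` (so `n` IS the conductor exponent of `𝒪_F[g]` in `𝒪[τ]`), then the fixed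
vertices of `g` are those of `γ₁` (★ `ncard_setOf_glVertexAct_conj_eq_self`, ★ `setOf_glVertexAct_smul_eq_self`) and the (W′1) shell machinery counts them.  The conjugation
itself is the consumer's (★ `exists_conj_eq_of_trace_eq_of_det_eq`: two non-scalar `2 × 2` matrices with equal trace and determinant are conjugate, any field).  With ★ p855177 ∕
★ p855231 (the `K₂` ∕ `K♯` columns of `U(Φ₂)` at a √u-type place as vertex ∕ edge counts) this is the last residue-characteristic-free input of the (ii-H) type-(2) H-side values;
what remains for the wild law is the DICTIONARY from the CM datum of `γ₂` to the torus-form datum `(u, v, a, b, n)` (census).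

* §1 **`ncard_setOf_glVertexAct_eq_self_of_inert_torusForm`** — `(q − 1)·#{x | g·x = x} + 2 = (q + 1)·qⁿ` (the VERTEX ball of radius `n`).
* §2 **`ncard_setOf_glVertexAct_eq_self_of_eisenstein_torusForm`** — `(q − 1)·#{x | g·x = x} + 2 = 2·q^{n+1}` (the EDGE-centred ball of radius `n`).

## References
* [LabesseLanglands1979] J.-P. Labesse, R. P. Langlands, *L-indistinguishability for SL(2)*, Canad. J. Math. 31 (1979), §2 p. 8 (`δ_m = (q+1)q^{m−1}` ∕ `2q^m`).
* [Serre1980Trees] J.-P. Serre, *Trees* (1980), Ch. II §1.1 (the `(q+1)`-regular tree of `SL₂`; balls), §1.3 (stabilisers).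
* [Kottwitz1988] R. E. Kottwitz, *Tamagawa numbers*, Ann. of Math. 127 (1988), §2 (fixed points of an elliptic element form a ball).
* [Serre1979] J.-P. Serre, *Local Fields*, GTM 67 (1979), Ch. I §6 (totally ramified extensions and Eisenstein polynomials), Ch. III §5 (unramified extensions).
-/

set_option autoImplicit false

noncomputable section

open scoped ValuativeRel Matrix MatrixGroups
open Matrix ValuativeRel

namespace Literature.NumberTheory.Automorphic.HermitianLatticeTree

open Literature.NumberTheory.Automorphic Literature.NumberTheory.LocalFields

section Ball

variable {F : Type*} [Field F] [ValuativeRel F] {ϖ : F} (hϖ : IsUniformizingElement ϖ) [IsDiscreteValuationRing 𝒪[F]]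

/-! ## §1 The vertex ball in inert torus-form tokens -/

include hϖ in
/-- **THE VERTEX BALL OF AN ELLIPTIC ELEMENT WITH INERT EIGEN-ORDER, TORUS-FORM TOKENS (any residue characteristic).**  Let `(u, v)` be an INERT datum (`u v ∈ 𝒪`, the norm
form `c² + ceu − e²v` anisotropic modulo `𝔭`: `hanis`), and let `g ∈ GL₂(F)` be conjugate UP TO A SCALAR to a unit of the inert order: `h g h⁻¹ = c·γ₁`, `γ₁ = (a, bv; b, a + bu)`,
`a b ∈ 𝒪`, `|det γ₁| = 1`, `c ≠ 0`, with `|b| = |ϖ|ⁿ`.  Then **`(q − 1)·#{x | g·x = x} + 2 = (q + 1)·qⁿ`** (`q = #𝓀_F`; `x` over the vertices of the tree of `SL₂(F)`, base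
vertex `v₀ = latt 1` a binder as in (W′1)) — ★ transport (`#Fix(hgh⁻¹) = #Fix(g)`, `Fix(c·γ₁) = Fix(γ₁)`) + ★ p846991 `ncard_setOf_glVertexAct_torus_eq_self_of_inert` with its
shell binders supplied (★ `exists_shellRep_fn`, ★ `exists_shellIndex` over ★ `integral_of_valuation_inertNorm_le_one`).  No `2 ≠ 0`, no non-square-residue unit: the
dyadic-safe form of ★ (2u). [cite: LabesseLanglands1979, §2 p. 8] [cite: Serre1980Trees, Ch. II §1.1] [cite: Kottwitz1988, §2] -/
theorem ncard_setOf_glVertexAct_eq_self_of_inert_torusForm [Finite (IsLocalRing.ResidueField 𝒪[F])] {u v : F} (hu : u ∈ 𝒪[F]) (hv : v ∈ 𝒪[F])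
    (hanis : ∀ c e : F, c ∈ 𝒪[F] → e ∈ 𝒪[F] → valuation F (c ^ 2 + c * e * u - e ^ 2 * v) < 1 → valuation F c < 1 ∧ valuation F e < 1)
    {g h γ₁ : GL (Fin 2) F} {c a b : F} (hc : c ≠ 0)
    (hconj : ((h * g * h⁻¹ : GL (Fin 2) F) : Matrix (Fin 2) (Fin 2) F) = c • (γ₁ : Matrix (Fin 2) (Fin 2) F))
    (hγ₁ : (γ₁ : Matrix (Fin 2) (Fin 2) F) = !![a, b * v; b, a + b * u]) (ha : a ∈ 𝒪[F]) (hb : b ∈ 𝒪[F])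
    (hγ₁det : valuation F (γ₁ : Matrix (Fin 2) (Fin 2) F).det = 1) {n : ℕ} (hbn : valuation F b = valuation F ϖ ^ n)
    (v₀ : {M : Submodule 𝒪[F] (Fin 2 → F) // IsSpecialLattice (RingHom.id F) ϖ !![(0 : F), 1; -1, 0] M}) (hv₀ : v₀.1 = latt (1 : Matrix (Fin 2) (Fin 2) F)) :
    (Nat.card (IsLocalRing.ResidueField 𝒪[F]) - 1) * {x : {M : Submodule 𝒪[F] (Fin 2 → F) // IsSpecialLattice (RingHom.id F) ϖ !![(0 : F), 1; -1, 0] M} | glVertexAct hϖ g x = x}.ncard + 2 =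
      (Nat.card (IsLocalRing.ResidueField 𝒪[F]) + 1) * Nat.card (IsLocalRing.ResidueField 𝒪[F]) ^ n := by
  have h0 := hϖ.ne_zero
  have hE := integral_of_valuation_inertNorm_le_one hanis
  have hv0 : v ≠ 0 := ne_zero_of_quadNormForm_integral hϖ hE
  -- transport: `#Fix(g) = #Fix(h g h⁻¹) = #Fix(γ₁)`
  have hfix : {x : {M : Submodule 𝒪[F] (Fin 2 → F) // IsSpecialLattice (RingHom.id F) ϖ !![(0 : F), 1; -1, 0] M} | glVertexAct hϖ g x = x}.ncard =
      {x | glVertexAct hϖ γ₁ x = x}.ncard := by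
    rw [← ncard_setOf_glVertexAct_conj_eq_self hϖ g h, setOf_glVertexAct_smul_eq_self hϖ hc hconj]
  rw [hfix]
  -- the shell machinery of (W′1) for the inert datum `(u, v)`
  have hdetτ : (!![(0 : F), v; 1, u]).det ≠ 0 := by rw [Matrix.det_fin_two_of]; simpa using hv0
  set γτ : GL (Fin 2) F := Matrix.GeneralLinearGroup.mk'' _ (isUnit_iff_ne_zero.2 hdetτ) with hγτ
  have hγτcoe : (γτ : Matrix (Fin 2) (Fin 2) F) = !![(0 : F), v; 1, u] := rfl
  obtain ⟨r, hr⟩ := exists_shellRep_fn (F := F) h0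
  obtain ⟨dd, hd, hd'⟩ := exists_shellIndex hϖ hu hv hE v₀ hv₀
  exact ncard_setOf_glVertexAct_torus_eq_self_of_inert hϖ hu hv hanis ha hb hbn hγ₁ hγ₁det hγτcoe hr v₀ hv₀ hd hd'

/-! ## §2 The edge-centred ball in Eisenstein torus-form tokens -/

include hϖ in
/-- **THE EDGE-CENTRED BALL OF AN ELLIPTIC ELEMENT WITH EISENSTEIN EIGEN-ORDER, TORUS-FORM TOKENS (any residue characteristic).**  Let `(u, v)` be an EISENSTEIN datum (`u ∈ 𝒪`,
`|u| < 1`, `|v| = |ϖ|`: `τ² = uτ + v` has a uniformiser root generating a totally ramified quadratic extension — every such extension arises this way, wild ones included),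
and let `g ∈ GL₂(F)` be conjugate up to a scalar to a unit of the Eisenstein order: `h g h⁻¹ = c·γ₁`, `γ₁ = (a, bv; b, a + bu)`, `a b ∈ 𝒪`, `|det γ₁| = 1`, `c ≠ 0`, `|b| = |ϖ|ⁿ`.
Then **`(q − 1)·#{x | g·x = x} + 2 = 2·q^{n+1}`** — ★ transport + ★ `ncard_setOf_glVertexAct_torus_eq_self_of_eisenstein` with its shell binders supplied (★ `exists_shellRep_fn`,
★ `exists_shellIndex` over ★ `quadNormForm_integral_of_eisenstein`).  No `2 ≠ 0`: the dyadic-safe form of ★ (2r). [cite: LabesseLanglands1979, §2 p. 8]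
[cite: Serre1980Trees, Ch. II §1.1] [cite: Kottwitz1988, §2] [cite: Serre1979, Ch. I §6] -/
theorem ncard_setOf_glVertexAct_eq_self_of_eisenstein_torusForm [Finite (IsLocalRing.ResidueField 𝒪[F])] {u v : F} (hu : u ∈ 𝒪[F]) (hu1 : valuation F u < 1)
    (hv1 : valuation F v = valuation F ϖ)
    {g h γ₁ : GL (Fin 2) F} {c a b : F} (hc : c ≠ 0)
    (hconj : ((h * g * h⁻¹ : GL (Fin 2) F) : Matrix (Fin 2) (Fin 2) F) = c • (γ₁ : Matrix (Fin 2) (Fin 2) F))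
    (hγ₁ : (γ₁ : Matrix (Fin 2) (Fin 2) F) = !![a, b * v; b, a + b * u]) (ha : a ∈ 𝒪[F]) (hb : b ∈ 𝒪[F])
    (hγ₁det : valuation F (γ₁ : Matrix (Fin 2) (Fin 2) F).det = 1) {n : ℕ} (hbn : valuation F b = valuation F ϖ ^ n)
    (v₀ : {M : Submodule 𝒪[F] (Fin 2 → F) // IsSpecialLattice (RingHom.id F) ϖ !![(0 : F), 1; -1, 0] M}) (hv₀ : v₀.1 = latt (1 : Matrix (Fin 2) (Fin 2) F)) :
    (Nat.card (IsLocalRing.ResidueField 𝒪[F]) - 1) * {x : {M : Submodule 𝒪[F] (Fin 2 → F) // IsSpecialLattice (RingHom.id F) ϖ !![(0 : F), 1; -1, 0] M} | glVertexAct hϖ g x = x}.ncard + 2 =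
      2 * Nat.card (IsLocalRing.ResidueField 𝒪[F]) ^ (n + 1) := by
  have h0 := hϖ.ne_zero
  have hvO : v ∈ 𝒪[F] := mem_integer_of_valuation_eq_uniformizer hϖ hv1
  have hv0 : v ≠ 0 := fun hz => by rw [hz, map_zero] at hv1; exact hϖ.ne_zero ((Valuation.zero_iff _).1 hv1.symm)
  have hE := quadNormForm_integral_of_eisenstein hϖ hu hu1 hv1
  -- transport: `#Fix(g) = #Fix(h g h⁻¹) = #Fix(γ₁)`
  have hfix : {x : {M : Submodule 𝒪[F] (Fin 2 → F) // IsSpecialLattice (RingHom.id F) ϖ !![(0 : F), 1; -1, 0] M} | glVertexAct hϖ g x = x}.ncard =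
      {x | glVertexAct hϖ γ₁ x = x}.ncard := by
    rw [← ncard_setOf_glVertexAct_conj_eq_self hϖ g h, setOf_glVertexAct_smul_eq_self hϖ hc hconj]
  rw [hfix]
  -- the shell machinery of (W′1) for the Eisenstein datum `(u, v)`
  have hdetτ : (!![(0 : F), v; 1, u]).det ≠ 0 := by rw [Matrix.det_fin_two_of]; simpa using hv0
  set γτ : GL (Fin 2) F := Matrix.GeneralLinearGroup.mk'' _ (isUnit_iff_ne_zero.2 hdetτ) with hγτ
  have hγτcoe : (γτ : Matrix (Fin 2) (Fin 2) F) = !![(0 : F), v; 1, u] := rfl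
  obtain ⟨r, hr⟩ := exists_shellRep_fn (F := F) h0
  obtain ⟨dd, hd, hd'⟩ := exists_shellIndex hϖ hu hvO hE v₀ hv₀
  exact ncard_setOf_glVertexAct_torus_eq_self_of_eisenstein hϖ hu hu1 hv1 ha hb hbn hγ₁ hγ₁det hγτcoe hr v₀ hv₀ hd hd'

end Ball

end Literature.NumberTheory.Automorphic.HermitianLatticeTree

end
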